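import Summits.ABC.ABC.Theses.IneffectiveSubspace
import Literature.NumberTheory.DiophantineGeometry.AbcDepthCensusFast

/-!
# `DeepRegimeABC` (stmt-ABC-15121): certified census of the deep tail, odd decades (B) — the cell `ω₅ ≥ 10` does not meet the box `c ≤ 10¹⁹`

Compute-certificate (line lead `prover-line-stmt-ABC-15121-c2-0`, 2026-08-16; human certificate
objective) for the crux `Summit.ABC.ABC.Theses.IneffectiveSubspace.DeepRegimeABC`, with the fast
soundness-proved enumeration checker
`Literature.NumberTheory.DiophantineGeometry.DepthCensus.checkCellFast` (`AbcDepthCensusFast.lean`,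
`depth_lt_of_checkCellFast`).  Second of three files (`…CensusDeepTailOddA.lean`: cells `8, 9, 12, 13, 14`
in the boxes `10¹⁵, 10¹⁷, 10²³, 10²⁵, 10²⁷`; `…CensusDeepTailOddC.lean`: cell `11` in `10²¹` and the
assembled bound `ω₅(abc) ≥ K ⟹ c > 10^(2K-1)`, `8 ≤ K ≤ 14`).

**Certified here.**  With the always-failing test the checker accepts the cell `ω₅ ≥ 10` in the box
`c ≤ 10¹⁹` (`checkCellFast_ten19`, 2 958 780 depth patterns, not a single lattice candidate), so
`ω₅(abc) ≤ 9` for every abc triple with `c ≤ 10¹⁹` (`depth_le_nine_of_le_tenPow19`; the cell was known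
to avoid `c ≤ 10¹⁸`, `…CensusDeepTail.lean`).  Pattern count = the independent C mirror
`cert/deep_census.c` of the lead's folder.  The only computation trusted to the compiler is the closed
`Bool` equation `checkCellFast … = true` (`native_decide`, computational certificate lane).
-/

-- `Summit.<Summit>.<Problem>` is the mandated summit-side namespace (CONVENTIONS §2); for the
-- single-conjunct summit `ABC` the two coincide, so the duplicate `ABC.ABC` is deliberate.
set_option linter.dupNamespace false

namespace Summit.ABC.ABC.Theorems.DeepRegimeABC

open Literature.NumberTheory.DiophantineGeometry
open Literature.NumberTheory.DiophantineGeometry.DepthCensus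

/-! ## The compiled run -/

/-- Cell `ω₅ ≥ 10`, box `10¹⁹` (`6310⁵ > 10¹⁹`): no lattice candidate. [folklore] -/
theorem checkCellFast_ten19 : checkCellFast (10 ^ 19) 6309 10 (fun _ _ _ => false) = true := by
  native_decide

/-! ## Depth bound in the box -/

/-- **`ω₅(abc) ≤ 9` for every abc triple with `c ≤ 10¹⁹`.** [folklore] -/
theorem depth_le_nine_of_le_tenPow19 {a b c : ℕ} (habc : IsABCTriple a b c) (hc : c ≤ 10 ^ 19) :
    ((a * b * c).primeFactors.filter (fun p => 5 ≤ (a * b * c).factorization p)).card ≤ 9 :=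
  Nat.le_of_lt_succ (depth_lt_of_checkCellFast (by norm_num) checkCellFast_ten19 habc hc)

/-! ## Registered certificate stub of the crux item (stmt-ABC-15121) -/

/-- **Registered certificate `censusDeepTailOddB`** (crux `DeepRegimeABC`, line SketchIdeator5R2, human
certificate objective): the deep cell `{ω₅ ≥ 10}` of the crux contains no abc triple with `c ≤ 10¹⁹`.
[folklore] -/
theorem censusDeepTailOddB : ∀ a b c : ℕ, Literature.NumberTheory.DiophantineGeometry.IsABCTriple a b c → c ≤ 10 ^ 19 → ((a * b * c).primeFactors.filter (fun p => 5 ≤ (a * b * c).factorization p)).card ≤ 9 :=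
  fun _ _ _ h hc => depth_le_nine_of_le_tenPow19 h hc

end Summit.ABC.ABC.Theorems.DeepRegimeABC
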